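import Literature.NumberTheory.EllipticCurves.BurungaleKobayashiNakamuraOta2026.LocalBottomIndex
import HarnessLib

/-!
# Burungale–Kobayashi–Nakamura–Ota 2026 (arXiv:2608.06879v1, PREPRINT), §3.3.1, Thm. 7.2, §1.4: the
# `p`-ADIC span `𝒪_𝔭 · x = (End_K(E) ⊗ ℤ_p) · x` of a family and the bottom / local index exponents
# over it — the CORRECTED CARRIER of the cell's K7r children (definitions with bodies + closure and
# uniqueness lemmas, PROVED; nothing asserted)

Topic `NumberTheory/EllipticCurves`, sub-directory `BurungaleKobayashiNakamuraOta2026` (author–year;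
namespace = path); sibling of `AnticyclotomicEllipticUnitClass.lean` (seat `bsd-cm-ram` g7, p441800:
the datum `EllipticUnitClassData`, `endSpan`, `HasBottomIndexExp`) and `LocalBottomIndex.lean` (seat
`bsd-cm-k7r-c3` g5, p449855: `HasLocalIndexExpOfEmb`, `HasLocalBottomIndexExp`). Cell `bsd-cm`
(run/shared/lean/pub/bsd-cm/), K7r route `route-BirchSwinnertonDyer-RamifiedSevenEllipticUnits`, planner
DECISION D117 (2026-08-26T18:42Z) adopting the repair (R1)–(R2) of the carrier audit
`pub/bsd-cm/bsd-cm-k7r-c4/g5/MEMO-k7r-c4-g5-CARRIER.md` (seat `bsd-cm-k7r-c4` g5; evidence #10 on item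
19705; independently found by seats k7r-c2 g4 (SB4-RECUT.md) and k8i-c2 g7 (kernel witness
`Theorems/RamifiedSevenEllipticUnitsBottomIndexVacuity.lean`, p462737)). HONEST STATUS: carriers and
definitions only; NO statement about any curve is asserted; the source is an unrefereed preprint
([claim: BurungaleKobayashiNakamuraOta2026, status: under-review]); the index exponents are DEFINITIONS
OF THE CELL (the objects of [BKNO] §1.4's deferred "`p`-part BSD formula at ramified primes").

## Why this file exists (the defect it repairs)

The sibling files read [BKNO]'s module `𝒪 · z(𝟙)` (§3.3.1: "`Λ_ac z^{ac}_{p^∞𝔣}`"; at the bottom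
layer the cyclic `𝒪 = 𝒪_K ⊗ ℤ_p = 𝒪_𝔭`-module generated by the bottom class) as
`WeierstrassCurve.endSpan p H x := AddSubgroup.closure {φ · x | φ ∈ End_K(E)}` — the **ℤ-span** of the
`End_K(E)`-translates, a quotient of `(End_K(E), +) ≅ ℤ²`, hence a COUNTABLE ℤ-lattice, not closed
under the `ℤ_p`-action `padicPi`.  The index predicates built on it (`HasBottomIndexExp`,
`HasLocalIndexExpOfEmb`, `HasLocalBottomIndexExp`: "`[ambient ℤ_p-module : torsion + endSpan x] = p^c`")
are therefore unsatisfiable at every frame where the ambient module contains a `ℤ_p`-line (every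
positive-rank frame): a finite index would embed `ℤ_p` into a countable group (memo §2; kernel:
`…Theorems.RamifiedSevenEllipticUnits.BottomLocalIndexSplit.relIndex_eq_zero_of_countable`,
`…Theorems.RamifiedBottomIndexVacuity.not_hasBottomIndexExp_of_padicFree`).  The intended object is the
**`ℤ_p`-span** of the translates, `𝒪_𝔭 · x`; this file types it (`padicEndSpan`) and re-types the three
exponents over it (`…Zp`), append-only (new names; the sibling files are untouched, D117).

## The printed statements (verbatim; `[BKNO]` = arXiv:2608.06879v1)

* §3.3.1 (PDF p. 19): "`z^{ac}_{p^∞𝔣} ∈ 𝒮^{ac}_rel`"; Prop. 3.7 (4): "`Ch(𝒮^{ac}_rel/Λ_ac z^{ac}_{p^∞𝔣}) ⊆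
  Ch(X^{ac}_str)`" — the module divided out is the `Λ_ac = 𝒪⟦Γ⟧`-span (`𝒪 ⊇ 𝒪_K ⊗ ℤ_p` a `p`-ADIC
  ring, §3.1.3), whose bottom specialisation is the `𝒪_𝔭`-span of `z(𝟙)`.
* Thm. 7.2 (= Thm. 1.8) (PDF p. 41), §1.4 (PDF p. 8): as quoted in the sibling files (the local exponent
  `λ₀` and the deferred `p`-part formula).

## Transcription

**(T1) `padicEndSpan p H x`** = `AddSubgroup.closure {c · (φ · x) | c ∈ ℤ_p, φ ∈ End_K(E)}` inside
`∏_k H¹(H, E[p^k])` — the `(End_K(E) ⊗ ℤ_p)`-span of `x`; it contains `endSpan x`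
(`endSpan_le_padicEndSpan`) and is closed under `padicPi` (`padicPi_mem_padicEndSpan`: `c·(c'·y) =
(cc')·y` levelwise) — so for a CM curve over its CM field it is `𝒪_𝔭 · x`, and
`[S_{p,rel}(E/K) : tors + 𝒪_𝔭 · z(𝟙)] = #(𝒪_𝔭/π^c) = p^c` is FINITE in analytic rank one (rank-one
`𝒪_𝔭`-lattices; `𝔭` ramified of residue degree one), the value the sibling docstrings describe.
**(T2)** `EllipticUnitClassData.HasBottomIndexExpZp`, `HasLocalIndexExpOfEmbZp` (+ `localPadicEndSpanOfEmb`),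
`EllipticUnitClassData.HasLocalBottomIndexExpZp`: the three exponents of the siblings with `endSpan`
replaced by `padicEndSpan`, everything else VERBATIM (relative to the datum; `AddSubgroup.relIndex`;
`= p^c` excludes the infinite index). Uniqueness and independence-of-the-datum relative to `𝓔` re-prove
verbatim (`…_unique`, `…_iff`). The junk analysis of the sibling (`scaleByP`: `(p⁻¹𝓔, p·z)` is again a
datum; the exponent moves by `2` in rank one) is unchanged: consumers bind `(Ω, 𝓔, D, c)` as SHARED
binders (D117 (R3): `X12/O11/RamifiedEllipticUnitMechanismZp.lean`).
**(T3) NOT here.** No statement S_dict/S_sat/S_B4′/S_open (Summits-side stubs of the line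
`rubin-formula-zp`); no `v_ε`/`ℒ_{p,v_ε}` (absent local Iwasawa cohomology, sibling (T4)).

## Main definitions and results (all `sorry`-free; no named fact; net debt 0)

* `WeierstrassCurve.padicEndSpan` (+ `endSpan_le_padicEndSpan`, `self_mem_padicEndSpan`,
  `padicPi_padicPi` (`c·(c'·y) = (cc')·y`), `padicPi_one`, `padicPi_mem_padicEndSpan`, `padicEndSpan_le`);
  `WeierstrassCurve.localPadicEndSpanOfEmb`, `WeierstrassCurve.HasLocalIndexExpOfEmbZp` (+ `_unique`).
* `EllipticUnitClassData.HasBottomIndexExpZp` (+ `_unique`, `_iff`), `EllipticUnitClassData.HasLocalBottomIndexExpZp`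
  (+ `_unique`, `_iff`).

## References

* [BurungaleKobayashiNakamuraOta2026] arXiv:2608.06879v1 §3.1.3, §3.3.1, Prop. 3.7, Thm. 7.2, §1.4.
* B. Perrin-Riou, Bull. SMF 115 (1987) §0 p. 401 (`S_p(L)` as compact `ℤ_p`-modules). [PerrinRiou1987BSMF]
* J. H. Silverman, *AEC* (2009) III.4 (End_K(E)), VIII.§2. [SilvermanAEC2009]
* Cell texts: MEMO-k7r-c4-g5-CARRIER.md (§1–§4), SB4-RECUT.md (k7r-c2), STATUS D117 (planner g19).
-/

noncomputable section

open scoped Classical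

open NumberField IsDedekindDomain Field
  Literature.NumberTheory.EllipticCurves Literature.NumberTheory.GaloisRepresentations

universe u

/-! ## Part 1. The `p`-adic `End_K(E)`-span of a family (any field `K`) -/

namespace WeierstrassCurve

variable {K : Type u} [Field K] (W : WeierstrassCurve K)

section Span

variable (p : ℕ) [Fact p.Prime] (H : Subgroup (Field.absoluteGaloisGroup K))

/-- **The `p`-ADIC `End_K(E)`-span `(End_K(E) ⊗ ℤ_p) · x` of a family `x ∈ ∏_k H¹(H, E[p^k])`**: the
additive subgroup generated by the `c · (φ · x)`, `c ∈ ℤ_p` (through the tree's `padicPi`), `φ ∈ End_K(E)`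
(through `endPi`).  For a CM curve over its CM field this is `𝒪_𝔭 · x`, `𝒪_𝔭 = 𝒪_K ⊗ ℤ_p` — [BKNO]'s
`𝒪 · z(𝟙)`, the bottom specialisation of `Λ_ac · z^{ac}` (§3.3.1, Prop. 3.7 (4)).  It CORRECTS the sibling's
`endSpan x` (the ℤ-span only; D117 / MEMO-k7r-c4-g5-CARRIER). [cite: BurungaleKobayashiNakamuraOta2026, §3.3.1 and Prop. 3.7 (4) (arXiv:2608.06879 pp. 19–20) (the module `Λ_ac z^{ac}`; shape only)] -/
def padicEndSpan (x : Π k : ℕ, W.torsionH1Over ((p : ℤ) ^ k) H) :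
    AddSubgroup (Π k : ℕ, W.torsionH1Over ((p : ℤ) ^ k) H) :=
  AddSubgroup.closure {y | ∃ (φ : AddMonoid.End W.geomPoints) (hφ : φ ∈ W.endRing) (c : ℤ_[p]),
    y = W.padicPi p H c (W.endPi hφ p H x)}

variable {W p H} in
omit [Fact p.Prime] in
/-- Levelwise, a natural number acts on `H¹(H, E[p^k])` through its residue mod `p^k` (the group is
killed by `p^k`: every class is represented by a cocycle with values in `E[p^k]`); private plumbing.
[cite: SilvermanAEC2009, VIII.§2 (cohomology of the finite module `E[m]`)] -/
private theorem mod_pow_smul_level (k n : ℕ) (y : W.torsionH1Over ((p : ℤ) ^ k) H) :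
    (n % p ^ k) • y = n • y := by
  have hk : (p ^ k) • y = 0 := by
    obtain ⟨φ, rfl⟩ := oneCocycleClass_surjective (discreteTopRep H (geomTorsion W ((p : ℤ) ^ k))) y
    refine nsmul_oneCocycleClass_eq_zero φ (p ^ k) fun g ↦ Subtype.ext ?_
    rw [AddSubmonoidClass.coe_nsmul, ← natCast_zsmul, Nat.cast_pow]
    exact (mem_geomTorsion_iff W _ _).1 (φ.1 g).2
  have h := congrArg (fun m : ℕ ↦ m • y) (Nat.mod_add_div n (p ^ k))
  simp only [add_smul, mul_comm (p ^ k), mul_smul, hk, smul_zero, add_zero] at h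
  exact h

/-- **`c · (c' · y) = (c c') · y`** for the `ℤ_p`-action `padicPi` (levelwise: residues multiply).
[cite: PerrinRiou1987BSMF, §0 p. 401 (the `ℤ_p`-module structure of `S_p(L)`)] -/
theorem padicPi_padicPi (c c' : ℤ_[p]) (y : Π k : ℕ, W.torsionH1Over ((p : ℤ) ^ k) H) :
    W.padicPi p H c (W.padicPi p H c' y) = W.padicPi p H (c * c') y := by
  funext k
  simp only [padicPi, AddMonoidHom.pi_apply, AddMonoidHom.coe_comp, Function.comp_apply,
    Pi.evalAddMonoidHom_apply, zsmulAddGroupHom_apply, natCast_zsmul, map_mul, ZMod.val_mul]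
  rw [smul_smul, mod_pow_smul_level]

/-- **`1 · y = y`** for `padicPi`. [cite: PerrinRiou1987BSMF, §0 p. 401 (the `ℤ_p`-module structure of `S_p(L)`)] -/
theorem padicPi_one (y : Π k : ℕ, W.torsionH1Over ((p : ℤ) ^ k) H) : W.padicPi p H 1 y = y := by
  funext k
  simp only [padicPi, AddMonoidHom.pi_apply, AddMonoidHom.coe_comp, Function.comp_apply,
    Pi.evalAddMonoidHom_apply, zsmulAddGroupHom_apply, natCast_zsmul, map_one]
  rw [ZMod.val_one_eq_one_mod, mod_pow_smul_level, one_smul]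

/-- `endSpan x ≤ padicEndSpan x` (`φ · x = 1 · (φ · x)`). [cite: BurungaleKobayashiNakamuraOta2026, §3.3.1 (arXiv:2608.06879 p. 19) (shape only)] -/
theorem endSpan_le_padicEndSpan (x : Π k : ℕ, W.torsionH1Over ((p : ℤ) ^ k) H) :
    W.endSpan p H x ≤ W.padicEndSpan p H x := by
  unfold endSpan padicEndSpan
  refine AddSubgroup.closure_mono ?_
  rintro y ⟨φ, hφ, rfl⟩
  exact ⟨φ, hφ, 1, (W.padicPi_one p H _).symm⟩

/-- `x ∈ padicEndSpan x`. [cite: BurungaleKobayashiNakamuraOta2026, §3.3.1 (arXiv:2608.06879 p. 19) (shape only)] -/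
theorem self_mem_padicEndSpan (x : Π k : ℕ, W.torsionH1Over ((p : ℤ) ^ k) H) :
    x ∈ W.padicEndSpan p H x :=
  W.endSpan_le_padicEndSpan p H x (W.self_mem_endSpan p H x)

/-- **`padicEndSpan x` is a `ℤ_p`-submodule**: closed under `padicPi c` (`c·(c'·φx) = (cc')·φx` on
generators; `padicPi c` is additive). [cite: PerrinRiou1987BSMF, §0 p. 401 (the `ℤ_p`-module structure of `S_p(L)`)] -/
theorem padicPi_mem_padicEndSpan (x : Π k : ℕ, W.torsionH1Over ((p : ℤ) ^ k) H) (c : ℤ_[p])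
    {y : Π k : ℕ, W.torsionH1Over ((p : ℤ) ^ k) H} (hy : y ∈ W.padicEndSpan p H x) :
    W.padicPi p H c y ∈ W.padicEndSpan p H x := by
  unfold padicEndSpan at hy ⊢
  induction hy using AddSubgroup.closure_induction with
  | mem y hy =>
    obtain ⟨φ, hφ, c', rfl⟩ := hy
    rw [padicPi_padicPi]
    exact AddSubgroup.subset_closure ⟨φ, hφ, c * c', rfl⟩
  | zero => rw [map_zero]; exact zero_mem _
  | add a b _ _ ha hb => rw [map_add]; exact add_mem ha hb
  | neg a _ ha => rw [map_neg]; exact neg_mem ha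

/-- **Universal property**: `padicEndSpan x ≤ N` for every subgroup `N ∋ x` stable under `End_K(E)` and
under `ℤ_p`. [cite: BurungaleKobayashiNakamuraOta2026, §3.3.1 (arXiv:2608.06879 p. 19) (shape only)] -/
theorem padicEndSpan_le {x : Π k : ℕ, W.torsionH1Over ((p : ℤ) ^ k) H}
    {N : AddSubgroup (Π k : ℕ, W.torsionH1Over ((p : ℤ) ^ k) H)} (hx : x ∈ N)
    (hEnd : ∀ (φ : AddMonoid.End W.geomPoints) (hφ : φ ∈ W.endRing) {y}, y ∈ N → W.endPi hφ p H y ∈ N)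
    (hZp : ∀ (c : ℤ_[p]) {y}, y ∈ N → W.padicPi p H c y ∈ N) : W.padicEndSpan p H x ≤ N := by
  unfold padicEndSpan
  rw [AddSubgroup.closure_le]
  rintro y ⟨φ, hφ, c, rfl⟩
  exact hZp c (hEnd φ hφ hx)

end Span

/-! ### The local exponent over the `p`-adic span -/

section LocalKummer

variable {E : Type u} [Field E] [Algebra K E] (ι : AlgebraicClosure K →ₐ[K] AlgebraicClosure E)
  (p : ℕ) [Fact p.Prime] (H : Subgroup (Field.absoluteGaloisGroup K))

/-- **`loc_ι(𝒪_𝔭 · x)`**: the image under the torsion-coefficient localisation `localTorsionResPi` of the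
`p`-adic span `padicEndSpan x` (the sibling's `localEndSpanOfEmb` with the corrected carrier).
[cite: BurungaleKobayashiNakamuraOta2026, §3.3.1 and Def. 4.7 (arXiv:2608.06879 pp. 19, 27) (shape only)] -/
def localPadicEndSpanOfEmb (x : W.torsionH1Pi p H) :
    AddSubgroup ((W.baseChange E).torsionH1Pi p (localSubgroupOfEmb H ι)) :=
  (W.padicEndSpan p H x).map (W.localTorsionResPi ι p H)

/-- `localEndSpanOfEmb x ≤ localPadicEndSpanOfEmb x`. [cite: BurungaleKobayashiNakamuraOta2026, §3.3.1 (arXiv:2608.06879 p. 19) (shape only)] -/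
theorem localEndSpanOfEmb_le_localPadicEndSpanOfEmb (x : W.torsionH1Pi p H) :
    W.localEndSpanOfEmb ι p H x ≤ W.localPadicEndSpanOfEmb ι p H x :=
  AddSubgroup.map_mono (W.endSpan_le_padicEndSpan p H x)

/-- **The LOCAL INDEX EXPONENT over the corrected carrier (`HasLocalIndexExpOfEmbZp ι x c`)**:
`loc_ι(𝒪_𝔭 · x)` consists of local Kummer classes (lies in `E(L·E) ⊗ ℤ_p`), and
`p^c = [E(L·E) ⊗ ℤ_p : (E(L·E) ⊗ ℤ_p)_{tors} + loc_ι(𝒪_𝔭 · x)]` — the sibling's `HasLocalIndexExpOfEmb`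
VERBATIM with `localEndSpanOfEmb` replaced by `localPadicEndSpanOfEmb`.  For the cell's K7r dictionary
(`E/ℚ` CM by `𝒪_K`, `p` ramified, `E(K_𝔭) ⊗ ℤ_p / tors ≅ 𝒪_𝔭` of rank one): `c = ord_π [E(K_𝔭) ⊗ ℤ_p :
𝒪_𝔭 · loc_𝔭 x]`, FINITE — the `λ₀` of the cell's Rubin-formula line when `x = z(𝟙)`. A DEFINITION of the
cell, junk-audited as the sibling; NOT in print ([BKNO] §1.4 "report elsewhere").
[cite: BurungaleKobayashiNakamuraOta2026, §1.4 and Thm. 7.2 (arXiv:2608.06879 pp. 8, 41) (claim; preprint; shape only — the object, not a statement)] -/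
def HasLocalIndexExpOfEmbZp (x : W.torsionH1Pi p H) (c : ℕ) : Prop :=
  W.localPadicEndSpanOfEmb ι p H x ≤ W.localKummerCompactOfEmb ι p H ∧
    (AddCommGroup.torsion ((W.baseChange E).torsionH1Pi p (localSubgroupOfEmb H ι)) ⊔
        W.localPadicEndSpanOfEmb ι p H x).relIndex (W.localKummerCompactOfEmb ι p H) = p ^ c

/-- At most one local index exponent over the corrected carrier. [cite: BurungaleKobayashiNakamuraOta2026, §1.4 and Thm. 7.2 (arXiv:2608.06879 pp. 8, 41) (shape only)] -/
theorem hasLocalIndexExpOfEmbZp_unique {x : W.torsionH1Pi p H} {c c' : ℕ}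
    (hc : W.HasLocalIndexExpOfEmbZp ι p H x c) (hc' : W.HasLocalIndexExpOfEmbZp ι p H x c') : c = c' :=
  Nat.pow_right_injective (Fact.out : p.Prime).two_le (hc.2.symm.trans hc'.2)

end LocalKummer

end WeierstrassCurve

/-! ## Part 2. [BKNO] bottom layer over the corrected carrier: `c(D)` and `λ₀(D)` -/

namespace Literature.NumberTheory.EllipticCurves.BurungaleKobayashiNakamuraOta2026

open WeierstrassCurve

section Bottom

variable {W : WeierstrassCurve ℚ} {p : ℕ} [Fact p.Prime] {K : Type} [Field K] [NumberField K]
  {𝔭 : HeightOneSpectrum (𝓞 K)} {κ : ZpExtension K p} {γ : absoluteGaloisGroup K}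
  {ι : PadicAlgCl p ≃+* ℂ} {φ : HeckeCharacter K} {Ω : ℂ} {𝓔 : AcDualExpSystem W p K 𝔭 κ ι}

namespace EllipticUnitClassData

variable [W.IsElliptic] (D : EllipticUnitClassData W p K 𝔭 κ γ ι φ Ω 𝓔)

/-- **The `π`-adic INDEX EXPONENT of the bottom class over the CORRECTED carrier
(`D.HasBottomIndexExpZp c`): `p^c = [S_{p,rel}(E/K) : S_{p,rel}(E/K)_{tors} + 𝒪_𝔭 · z(𝟙)]`** — the sibling's
`HasBottomIndexExp` VERBATIM with `endSpan (D.z 0)` replaced by the `p`-adic span `padicEndSpan (D.z 0)`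
(`𝒪_𝔭 = End_K(E) ⊗ ℤ_p`).  WHY `p^c`: in analytic rank one `S_{p,rel}(E/K)/tors` is a torsion-free
`𝒪_𝔭`-module of rank one, `𝒪_𝔭 · z(𝟙) = π^c · (generator)` and `#(𝒪_𝔭/π^c) = p^c` (`𝔭` ramified of
residue degree one) — FINITE, unlike over the ℤ-span (memo §2). RELATIVE to `𝓔` (the sibling's (T2):
`scaleByP` moves `c` by `2`); consumers bind `(Ω, 𝓔, D, c)` as shared binders. NOT in print (§1.4) — a
DEFINITION of the cell. [cite: BurungaleKobayashiNakamuraOta2026, §1.4 and Thm. 7.2 (arXiv:2608.06879 pp. 8, 41) (claim; preprint; shape only — the object, not a statement)] -/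
def HasBottomIndexExpZp (c : ℕ) : Prop :=
  (AddCommGroup.torsion (Π k : ℕ, (W.baseChange K).torsionH1Over ((p : ℤ) ^ k) (κ.layerSubgroup 0)) ⊔
      (W.baseChange K).padicEndSpan p (κ.layerSubgroup 0) (D.z 0)).relIndex
    ((W.baseChange K).relaxedCompactSelmerOver (κ.layerSubgroup 0) p {𝔭}) = p ^ c

/-- At most one bottom index exponent (injectivity of `c ↦ p^c`). [cite: BurungaleKobayashiNakamuraOta2026, §1.4 and Thm. 7.2 (arXiv:2608.06879 pp. 8, 41) (shape only)] -/
theorem hasBottomIndexExpZp_unique {c c' : ℕ} (hc : D.HasBottomIndexExpZp c)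
    (hc' : D.HasBottomIndexExpZp c') : c = c' := by
  unfold HasBottomIndexExpZp at hc hc'
  exact Nat.pow_right_injective (Fact.out : p.Prime).two_le (hc.symm.trans hc')

/-- **The bottom index exponent is independent of the datum** (relative to `𝓔`): two data over the same
`(ι, φ, Ω, 𝓔)` have the same bottom class (`z_eq`, modulo `CompactAcSelmerVanishes` = [BKNO] Prop. 3.7 (3)
+ Lemma 5.2 and the entire continuations), hence the same exponent. [cite: BurungaleKobayashiNakamuraOta2026, Prop. 3.7 (3) (arXiv:2608.06879 p. 19) (claim; preprint; shape only)] -/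
theorem hasBottomIndexExpZp_iff (hS : CompactAcSelmerVanishes W p K κ γ)
    (hcont : ∀ χ : HeckeCharacter K, LFunction.HasEntireContinuation (heckeLFunction (φ * χ)))
    (D D' : EllipticUnitClassData W p K 𝔭 κ γ ι φ Ω 𝓔) (c : ℕ) :
    D.HasBottomIndexExpZp c ↔ D'.HasBottomIndexExpZp c := by
  unfold HasBottomIndexExpZp
  rw [z_eq hS hcont D D' 0]

/-- **`λ₀(D)` over the CORRECTED carrier (`D.HasLocalBottomIndexExpZp c`)**: `loc_𝔭(𝒪_𝔭 · z(𝟙))`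
consists of local Kummer classes and `p^c = [E(K_𝔭) ⊗ ℤ_p : tors + 𝒪_𝔭 · loc_𝔭 z(𝟙)]` — the sibling's
`HasLocalBottomIndexExp` VERBATIM over `HasLocalIndexExpOfEmbZp` (bottom layer `κ.layerSubgroup 0`, chosen
embedding `closureEmb (𝔭.adicCompletion K)`).  By [BKNO] Thm. 7.2 at `χ = 𝟙` and the cell's unit bottom
period, `c = ord_π ℒ_{p,v_ε}(φ)(𝟙)`; the corrected Rubin-formula line reads `λ₀(D) = c(D) + m_loc`.
RELATIVE to `𝓔`; a DEFINITION of the cell; NOT in print (§1.4).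
[cite: BurungaleKobayashiNakamuraOta2026, Thm. 7.2 and §1.4 (arXiv:2608.06879 pp. 8, 41) (claim; preprint; shape only — the object, not a statement)] -/
def HasLocalBottomIndexExpZp (c : ℕ) : Prop :=
  (W.baseChange K).HasLocalIndexExpOfEmbZp (closureEmb (K := K) (𝔭.adicCompletion K)) p
    (κ.layerSubgroup 0) (D.z 0) c

/-- At most one `λ₀(D)` over the corrected carrier. [cite: BurungaleKobayashiNakamuraOta2026, §1.4 and Thm. 7.2 (arXiv:2608.06879 pp. 8, 41) (shape only)] -/
theorem hasLocalBottomIndexExpZp_unique {c c' : ℕ} (hc : D.HasLocalBottomIndexExpZp c)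
    (hc' : D.HasLocalBottomIndexExpZp c') : c = c' :=
  (W.baseChange K).hasLocalIndexExpOfEmbZp_unique _ p _ hc hc'

/-- **`λ₀` over the corrected carrier is independent of the datum** (relative to `𝓔`; `z_eq`).
[cite: BurungaleKobayashiNakamuraOta2026, Prop. 3.7 (3) (arXiv:2608.06879 p. 19) (claim; preprint; shape only)] -/
theorem hasLocalBottomIndexExpZp_iff (hS : CompactAcSelmerVanishes W p K κ γ)
    (hcont : ∀ χ : HeckeCharacter K, LFunction.HasEntireContinuation (heckeLFunction (φ * χ)))
    (D D' : EllipticUnitClassData W p K 𝔭 κ γ ι φ Ω 𝓔) (c : ℕ) :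
    D.HasLocalBottomIndexExpZp c ↔ D'.HasLocalBottomIndexExpZp c := by
  unfold HasLocalBottomIndexExpZp
  rw [z_eq hS hcont D D' 0]

end EllipticUnitClassData

end Bottom

end Literature.NumberTheory.EllipticCurves.BurungaleKobayashiNakamuraOta2026

end
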